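import Summits.PneNP.PneNP.Theorems.ConvexRankGatesLinAlgGateBlindGRankLogWidth

/-!
# Route ConvexRankGates, crux `LinAlgGateBlind` (stmt-PneNP-10681): the crux with the gate parameter decoupled from the size exponent — proved

Support theorems for the crux (vocabulary of `Theorems/ConvexRankGatesLinAlgGateBlindDefs.lean`). The crux
`Summit.PneNP.PneNP.Theses.ConvexRankGates.LinAlgGateBlind` couples the gate parameter to the size exponent: circuits of
size `≤ m^c` over `{∧₂, ∨₂} ∪ PERM_{m^c} ∪ GRANK_{m^c}` for EVERY natural `c` — and so implies Valiant's hypothesis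
(`dcPerSuperpolynomial_of_linAlgGateBlind`). With the gate parameter a FIXED real power `⌊m^γ⌋` (size still `≤ m^c` for
every `c`) the statement is a theorem, by the PERM door at logarithmic width (`sgAt_perm_logWidth`, range `7/8`) and the
GRANK door of `…GRankLogWidth` (`sgAt_gRank_logWidth`, range `7/16`):

* `not_computes_clique_of_isOver_perm_rpow_gRank_rpow` — for every `c`, every `γ₁ < 7/8` and every `γ₂ < 7/16`,
  eventually in `m`, no circuit over `{∧₂, ∨₂} ∪ PERM_{⌊m^{γ₁}⌋} ∪ GRANK_{⌊m^{γ₂}⌋}` with `≤ m^c` gates computes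
  `CLIQUE(m, ⌈m^{1/8}⌉)`;
* `linAlgGateBlind_decoupled` — THE CRUX'S TEXT VERBATIM (inline gate classes `Lin`, inline clique function, same
  quantifier shape `∃ δ ∈ (0,1/2), ∀ c, …`) with `Lin (m ^ c)` replaced by `Lin ⌊m^γ⌋₊`, `γ < 7/16` quantified next to
  `c`: proved with `δ = 1/8`.

Both unconditional. Auxiliary: the eventual inequalities `⌊m^γ⌋² ≤ m^{7/8}/(log₂ m)^5` (`γ < 7/16`) and
`⌊m^γ⌋ log₂ ⌊m^γ⌋ ≤ m^{7/8}/(log₂ m)^5` (`γ < 7/8`). Sources: Razborov 1985, Alon–Boppana 1987 §3; doors, host and covers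
are the tree's. No new definitions. [folklore]
-/

-- `Summit.PneNP.PneNP.…` duplicates `PneNP` BY DESIGN (single-problem summit).
set_option linter.dupNamespace false

noncomputable section

namespace Summit.PneNP.PneNP.Theorems

open Finset Filter Literature.Computability.Complexity Razborov
open Summit.PneNP.PneNP.Cruxes.LinAlgGateBlind.DnfInvariantWideGatesSeeSmallCliques
open Summit.PneNP.PneNP.Cruxes.LinAlgGateBlind.DnfInvariantWideGatesSeeSmallCliques.DenseRegime

/-! ### Eventual ranges of the two gate parameters -/

/-- Eventually `⌊m^γ⌋² ≤ m^{7/8}/(log₂ m)^5` for every `γ < 7/16` (`(log₂ m)^5 ≤ m^{7/8 - 2γ}` eventually). [folklore] -/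
theorem eventually_floor_rpow_sq_le {γ : ℝ} (hγ : γ < 7 / 16) :
    ∀ᶠ m : ℕ in atTop, ((⌊(m : ℝ) ^ γ⌋₊ : ℕ) : ℝ) ^ 2 ≤ (m : ℝ) ^ (7 / 8 : ℝ) / Real.logb 2 m ^ 5 := by
  have hη : 0 < 7 / 8 - 2 * γ := by linarith
  filter_upwards [eventually_logb_pow_le_rpow 5 hη, eventually_ge_atTop 3] with m hlog hm3
  have hmpos : (0 : ℝ) < m := by exact_mod_cast (show 0 < m by omega)
  have hℓ1 : 1 ≤ Real.logb 2 m := (one_le_log hm3).trans (log_le_logb_two m)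
  have hℓ5 : 0 < Real.logb 2 m ^ 5 := by positivity
  have h0 : (0 : ℝ) ≤ (m : ℝ) ^ γ := Real.rpow_nonneg (Nat.cast_nonneg m) _
  rw [le_div_iff₀ hℓ5]
  calc ((⌊(m : ℝ) ^ γ⌋₊ : ℕ) : ℝ) ^ 2 * Real.logb 2 m ^ 5
      ≤ ((m : ℝ) ^ γ) ^ 2 * (m : ℝ) ^ (7 / 8 - 2 * γ) :=
        mul_le_mul (pow_le_pow_left₀ (Nat.cast_nonneg _) (Nat.floor_le h0) 2) hlog hℓ5.le (by positivity)
    _ = (m : ℝ) ^ (7 / 8 : ℝ) := by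
        rw [← Real.rpow_natCast, ← Real.rpow_mul hmpos.le, ← Real.rpow_add hmpos]
        norm_num
        ring_nf

/-- Eventually `⌊m^γ⌋ · log₂ ⌊m^γ⌋ ≤ m^{7/8}/(log₂ m)^5` for every `γ < 7/8` (`⌊m^γ⌋ ≤ m^γ ≤ m`, so the left side is
`≤ m^γ log₂ m`, and `(log₂ m)^6 ≤ m^{7/8 - γ}` eventually). [folklore] -/
theorem eventually_floor_rpow_mul_logb_le {γ : ℝ} (hγ : γ < 7 / 8) :
    ∀ᶠ m : ℕ in atTop, ((⌊(m : ℝ) ^ γ⌋₊ : ℕ) : ℝ) * Real.logb 2 (⌊(m : ℝ) ^ γ⌋₊ : ℕ) ≤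
      (m : ℝ) ^ (7 / 8 : ℝ) / Real.logb 2 m ^ 5 := by
  have hη : 0 < 7 / 8 - γ := by linarith
  filter_upwards [eventually_logb_pow_le_rpow 6 hη, eventually_ge_atTop 3] with m hlog hm3
  have hm1 : (1 : ℝ) ≤ m := by exact_mod_cast (show 1 ≤ m by omega)
  have hmpos : (0 : ℝ) < m := by linarith
  have hℓ1 : 1 ≤ Real.logb 2 m := (one_le_log hm3).trans (log_le_logb_two m)
  have hℓ5 : 0 < Real.logb 2 m ^ 5 := by positivity
  have h0 : (0 : ℝ) ≤ (m : ℝ) ^ γ := Real.rpow_nonneg (Nat.cast_nonneg m) _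
  have hdle : ((⌊(m : ℝ) ^ γ⌋₊ : ℕ) : ℝ) ≤ (m : ℝ) ^ γ := Nat.floor_le h0
  rw [le_div_iff₀ hℓ5]
  rcases Nat.eq_zero_or_pos ⌊(m : ℝ) ^ γ⌋₊ with hd | hd
  · rw [hd]
    simp only [Nat.cast_zero, zero_mul]
    exact Real.rpow_nonneg (Nat.cast_nonneg m) _
  · have hd0 : (0 : ℝ) < ((⌊(m : ℝ) ^ γ⌋₊ : ℕ) : ℝ) := by exact_mod_cast hd
    have hdm : ((⌊(m : ℝ) ^ γ⌋₊ : ℕ) : ℝ) ≤ m :=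
      hdle.trans ((Real.rpow_le_rpow_of_exponent_le hm1 (by linarith : γ ≤ 1)).trans_eq (Real.rpow_one _))
    have hlogd : Real.logb 2 (⌊(m : ℝ) ^ γ⌋₊ : ℕ) ≤ Real.logb 2 m := Real.logb_le_logb_of_le one_lt_two hd0 hdm
    have hlogd0 : 0 ≤ Real.logb 2 (⌊(m : ℝ) ^ γ⌋₊ : ℕ) :=
      Real.logb_nonneg one_lt_two (by exact_mod_cast hd)
    calc ((⌊(m : ℝ) ^ γ⌋₊ : ℕ) : ℝ) * Real.logb 2 (⌊(m : ℝ) ^ γ⌋₊ : ℕ) * Real.logb 2 m ^ 5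
        ≤ (m : ℝ) ^ γ * Real.logb 2 m * Real.logb 2 m ^ 5 :=
          mul_le_mul_of_nonneg_right (mul_le_mul hdle hlogd hlogd0 h0) hℓ5.le
      _ = (m : ℝ) ^ γ * Real.logb 2 m ^ 6 := by ring
      _ ≤ (m : ℝ) ^ γ * (m : ℝ) ^ (7 / 8 - γ) := mul_le_mul_of_nonneg_left hlog h0
      _ = (m : ℝ) ^ (7 / 8 : ℝ) := by
          rw [← Real.rpow_add hmpos]
          norm_num

/-! ### Separate real exponents for the two halves: PERM below `7/8`, GRANK below `7/16` -/

/-- **Two real exponents.** For every `c`, every `γ₁ < 7/8` and every `γ₂ < 7/16`, eventually in `m`: no circuit over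
`{∧₂, ∨₂} ∪ PERM_{⌊m^{γ₁}⌋} ∪ GRANK_{⌊m^{γ₂}⌋}` with `≤ m^c` gates computes `CLIQUE(m, ⌈m^{1/8}⌉)` (unconditional) — the
PERM half at the union-bound limit `7/8` (`sgAt_perm_logWidth`), the GRANK half at `7/16` (`sgAt_gRank_logWidth`).
[folklore] -/
theorem not_computes_clique_of_isOver_perm_rpow_gRank_rpow : ∀ (c : ℕ) (γ₁ γ₂ : ℝ), γ₁ < 7 / 8 → γ₂ < 7 / 16 →
    ∀ᶠ m : ℕ in atTop, ∀ C : Circuit (KEdge m),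
      C.IsOver ({GateFn.and 2, GateFn.or 2} ∪
        {g | IsPermGate ⌊(m : ℝ) ^ γ₁⌋₊ g ∨ IsGRankGate ⌊(m : ℝ) ^ γ₂⌋₊ g}) →
      C.size ≤ m ^ c → ¬ C.Computes (cliqueFn m ⌈(m : ℝ) ^ (1 / 8 : ℝ)⌉₊) := by
  intro c γ₁ γ₂ h₁ h₂
  filter_upwards [not_computes_clique_of_isOver_perm_gRank_logWidth c, eventually_floor_rpow_mul_logb_le h₁,
    eventually_floor_rpow_sq_le h₂] with m hm hd hs C hC hsize
  exact hm _ _ hd hs C hC hsize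

/-! ### The crux with the gate parameter decoupled from the size exponent, in the crux's own words -/

open scoped Classical in
/-- **The decoupled crux, proved.** The statement of the crux `Summit.PneNP.PneNP.Theses.ConvexRankGates.LinAlgGateBlind`
VERBATIM (same inline gate classes `Lin`, same inline clique function, same quantifier shape), except that the gate
parameter `Lin (m ^ c)` is replaced by `Lin ⌊m^γ⌋₊` for a real exponent `γ < 7/16` quantified next to `c`: there is
`δ ∈ (0, 1/2)` (namely `δ = 1/8`) such that for every `c` and every `γ < 7/16`, eventually in `m`, no circuit with `≤ m^c`
gates over `{∧₂, ∨₂} ∪ PERM_{⌊m^γ⌋} ∪ GRANK_{⌊m^γ⌋}` computes `CLIQUE(m, ⌈m^δ⌉)`. Unconditional; it is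
`not_computes_clique_of_isOver_lin_rpow` read back through the `Iff.rfl` of `linAlgGateBlind_iff_reduction`. The crux itself
(`γ` replaced by the natural `c`, i.e. gate parameter `m^c` for all `c`) implies Valiant's hypothesis
(`dcPerSuperpolynomial_of_linAlgGateBlind`). [folklore] -/
theorem linAlgGateBlind_decoupled :
    let Lin : ℕ → Set Literature.Computability.Complexity.GateFn := fun s => {g | (∃ d : ℕ, d ≤ s ∧ ∃ (σ : Fin g.1 → Equiv.Perm (Fin d)) (τ : Equiv.Perm (Fin d)), ∀ v : Fin g.1 → Bool, g.2 v = true ↔ τ ∈ Subgroup.closure (σ '' {i | v i = true})) ∨ (∃ (F : Type) (_ : Field F) (d θ : ℕ), d ≤ s ∧ ∃ (K₀ : Matrix (Fin d) (Fin d) F) (K : Fin g.1 → Matrix (Fin d) (Fin d) F), ∀ v : Fin g.1 → Bool, g.2 v = true ↔ θ ≤ (K₀.map (algebraMap F (FractionRing (MvPolynomial (Fin g.1) F))) + ∑ i, if v i then (algebraMap (MvPolynomial (Fin g.1) F) (FractionRing (MvPolynomial (Fin g.1) F)) (MvPolynomial.X i)) • (K i).map (algebraMap F (FractionRing (MvPolynomial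 (Fin g.1) F))) else 0).rank)};
    ∃ δ : ℝ, 0 < δ ∧ δ < 1 / 2 ∧ ∀ (c : ℕ) (γ : ℝ), γ < 7 / 16 → ∀ᶠ m : ℕ in atTop,
      ∀ C : Literature.Computability.Complexity.Circuit ((⊤ : SimpleGraph (Fin m)).edgeSet),
        C.IsOver ({Literature.Computability.Complexity.GateFn.and 2, Literature.Computability.Complexity.GateFn.or 2} ∪
          Lin ⌊(m : ℝ) ^ γ⌋₊) → C.size ≤ m ^ c →
        ¬ C.Computes (fun x => decide (¬ (SimpleGraph.fromEdgeSet {e : Sym2 (Fin m) |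
          ∃ h : e ∈ (⊤ : SimpleGraph (Fin m)).edgeSet, x ⟨e, h⟩ = true}).CliqueFree ⌈(m : ℝ) ^ δ⌉₊)) := by
  intro Lin
  refine ⟨1 / 8, by norm_num, by norm_num, fun c γ hγ => ?_⟩
  exact not_computes_clique_of_isOver_lin_rpow c γ hγ

end Summit.PneNP.PneNP.Theorems

end
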